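/-
Copyright (c) 2026 the pub-hodgecm-mathlib formalisation cell (harness21).  Prover seat hodgecm-mathlib-K2E3-p12 (g4), Track B «K2-LIT» ∕ h413
(`stmt-HodgeConjecture-24833`), line `K2_E3_EllipticInputs`, unit U12-d, §L (Gp-a, FILE 1): THE ORBITS OF AN OPEN SUBGROUP `Gp ≤ GL₂(F)` ON THE PUNCTURED NILPOTENT
CONE `𝒩 ∖ {0} ⊂ 𝔤𝔩₂(F)` — each is clopen in `𝒩 ∖ {0}`, locally closed in `𝔤𝔩₂(F)`, and carries the invariant Radon measure `val^* ν`.  2026-09-04.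
-/
import Summits.HodgeConjecture.HodgeConjecture.Theorems.K2E3GL2RegularNilpotentOrbitSpace          -- ★ p856983 (this seat, S2b): the full orbit `𝒩 ∖ {0}` and `ν`
import Literature.MeasureTheory.Group.ConjClassLocallyClosedEmbedding                              -- ★ `continuousSMul_orbit`
import Mathlib.Topology.Algebra.Group.OpenMapping
import HarnessLib

/-!
# K2_E3 road (h413), §L — (Gp-a) FILE 1: the `Gp`-orbits on the punctured nilpotent cone of `𝔤𝔩₂(F)`, for an open subgroup `Gp ≤ GL₂(F)`

Cell `pub/hodgecm-mathlib` (D-0151), Track B, seat K2E3-p12 (g4), §L line lead (§L RULINGS #2∕#3, MEMO v3 `K2/K2E3-p12/g4/MEMO-SL-LieCores-line.v3.K2E3-p12-g4.md`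
76bc1f2b, road «U-iso-T»).  `--supports stmt-HodgeConjecture-24833 --as helper`; THEOREMS ONLY (no definition ∕ instance ∕ notation ∕ named fact ∕ `sorry`); never imports
`Cruxes/…/Lines`.  COUNT-NEUTRAL.

WHY.  The isotropic half of (L-B_U)′ (U12 :373 at `N = 2`, the quasi-split `U(1,1)`) transports (MEMO v3 (T1)–(T4)) to invariant distributions on `𝔤𝔩₂(F)` under the OPEN
index-two subgroup `G⁺ = {g : det g ∈ Nm_{E/F}(Eˣ)}`, whose action splits `𝒩 ∖ {0}` into TWO orbits.  The structure theorem «`J(𝒩)^{Gp} = ℂδ₀ ⊕ ⊕_𝒪 ℂ·ν|_𝒪`» for ANY open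
`Gp ≤ GL₂(F)` is ★ S2b∕S2c (p856983∕p857002, the case `Gp = GL₂(F)`) orbit by orbit; this file is the orbit-space half (the twin of S2b), FILE 2
`K2E3GL2NilpotentSubgroupOrbitUniqueness` the uniqueness half, FILE 3 the assembly over the finitely many orbits meeting a compact support.

SETTING.  `G := ConjAct (GL (Fin 2) F)` ↷ `𝔤𝔩₂(F)` (Mathlib `ConjAct.units_smul_def`), `Gp : Subgroup G`, acting through Mathlib's `Subgroup.instMulAction`
(`Subgroup.smul_def`); OPENNESS is phrased without a topology on the synonym: `IsOpen {g : GL (Fin 2) F | ConjAct.toConjAct g ∈ Gp}`.  `x₀ ∈ 𝒩 ∖ {0}` a base point,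
`𝒪 := MulAction.orbit ↥Gp x₀`, `X := ↥𝒪`, `ν = chart_*(κ ⊗ dx)` (★ p856878), `μ := Measure.comap Subtype.val ν` on `X`.
* §1 (any field) `orbit_subgroup_subset` (`𝒪 ⊆ 𝒩 ∖ {0}` = the `G`-orbit of `E₁₂`, ★ `mem_orbit_nilpOne_iff`), `smul_mem_orbit_subgroup`, `image_val_preimage_smul_subgroup`.
* §2 (non-archimedean local `F`) **`exists_isOpen_inter_orbit_eq`**: `𝒪 = U ∩ (𝒩 ∖ {0})` with `U` OPEN — the orbit map `G → 𝒩 ∖ {0}` is open (Mathlib's Baire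
  open-mapping theorem `isOpenMap_smul_of_sigmaCompact` on the locally compact orbit, as in ★ S2c) and `Gp` is open; hence `exists_isOpen_inter_orbit_eq_diff`
  (the complement in `𝒩 ∖ {0}` is open too: a union of other `Gp`-orbits), **`isLocallyClosed_orbit_subgroup`**, `closure_orbit_subgroup_subset` (`⊆ 𝒪 ∪ {0}`),
  **`isClosed_setOf_isNilpotent_diff_orbit_subgroup`** (`𝒩 ∖ 𝒪` is closed — the set the extensions of FILE 2 must avoid), `measurableSet_orbit_subgroup`,
  `locallyCompactSpace_orbit_subgroup`.
* §3 the measure `μ = val^* ν` on `X`: `comap_val_apply_subgroup`, **`isFiniteMeasureOnCompacts_comap_val_subgroup`**, **`smulInvariantMeasure_comap_val_subgroup`**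
  (★ `map_conj_map_conjNilp`), **`comap_val_subgroup_ne_zero`** (`ν(U) > 0`: `chart⁻¹(U)` is a non-empty open subset of `GL₂(𝒪) × F`, ★ `exists_glInt_conj_nilp_eq`), and
  **`integral_comp_val_comap_val_subgroup`**: `∫_X f∘val dμ = ∫_{chart⁻¹ 𝒪} f∘chart d(κ ⊗ dx)` — the `Gp`-orbital integral `ν|_𝒪(f)` in the `K × F` chart.
[HarishChandra1999AdmissibleDistributions, §3 pp. 8–10; BernsteinZelevinsky1976 §1.5, §1.18; RangaRao1972].

References: [HarishChandra1999AdmissibleDistributions] Harish-Chandra (DeBacker–Sally), AMS ULECT 16 (1999), §3, Thm. 3.9, Cor. 3.10 · [BernsteinZelevinsky1976] Russian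
Math. Surveys 31:3 (1976), §1.5, §1.18 · [RangaRao1972] Ann. of Math. 96 (1972) 505–510.
-/

set_option autoImplicit false
set_option linter.dupNamespace false   -- `Summit.HodgeConjecture.HodgeConjecture.…` (D-0017 nested layout; lakefile exemption for Summits)

noncomputable section

open MeasureTheory Measure Filter Topology TopologicalSpace
open scoped MatrixGroups NNReal ENNReal
open Literature.NumberTheory.Rogawski1990 Literature.NumberTheory.Automorphic Literature.NumberTheory.Automorphic.LocalFieldHaar
open Literature.NumberTheory.GaloisRepresentations Literature.NumberTheory.GaloisRepresentations.IsNonarchimedeanLocalField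
open Summit.HodgeConjecture.HodgeConjecture.Cruxes.H413.K2E3GL2RegularNilpotentOrbitalMeasure
open Summit.HodgeConjecture.HodgeConjecture.Cruxes.H413.K2E3GL2RegularNilpotentOrbitStructure
open Summit.HodgeConjecture.HodgeConjecture.Cruxes.H413.K2E3GL2RegularNilpotentOrbitPushforward
open Summit.HodgeConjecture.HodgeConjecture.Cruxes.H413.K2E3GL2RegularNilpotentOrbitSpace

namespace Summit.HodgeConjecture.HodgeConjecture.Cruxes.H413.K2E3GL2NilpotentSubgroupOrbitSpace

/-! ## §1  The `Gp`-orbit of a point of the punctured nilpotent cone (any field) -/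

section Orbit

variable {F : Type*} [Field F] (Gp : Subgroup (ConjAct (GL (Fin 2) F))) {x₀ : Matrix (Fin 2) (Fin 2) F}

/-- The `Gp`-orbit of a non-zero nilpotent `x₀` lies in the punctured nilpotent cone `𝒩 ∖ {0} = G • E₁₂` (★ `mem_orbit_nilpOne_iff`).
[cite: HarishChandra1999AdmissibleDistributions, §3 p. 8] -/
theorem orbit_subgroup_subset (hx₀ : IsNilpotent x₀) (h0 : x₀ ≠ 0) :
    MulAction.orbit ↥Gp x₀ ⊆ MulAction.orbit (ConjAct (GL (Fin 2) F)) (!![0, 1; 0, 0] : Matrix (Fin 2) (Fin 2) F) := by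
  rintro _ ⟨h, rfl⟩
  obtain ⟨g, hg⟩ := MulAction.mem_orbit_iff.1 ((mem_orbit_nilpOne_iff x₀).2 ⟨hx₀, h0⟩)
  show h • x₀ ∈ _
  rw [Subgroup.smul_def, ← hg, ← mul_smul]
  exact MulAction.mem_orbit _ _

/-- Points of the `Gp`-orbit are nilpotent and non-zero. [cite: HarishChandra1999AdmissibleDistributions, §3 p. 8] -/
theorem isNilpotent_and_ne_zero_of_mem_orbit_subgroup (hx₀ : IsNilpotent x₀) (h0 : x₀ ≠ 0) {y : Matrix (Fin 2) (Fin 2) F}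
    (hy : y ∈ MulAction.orbit ↥Gp x₀) : IsNilpotent y ∧ y ≠ 0 :=
  (mem_orbit_nilpOne_iff y).1 (orbit_subgroup_subset Gp hx₀ h0 hy)

/-- `0` is not on the `Gp`-orbit of a non-zero nilpotent. [cite: HarishChandra1999AdmissibleDistributions, §3 p. 8] -/
theorem zero_notMem_orbit_subgroup (hx₀ : IsNilpotent x₀) (h0 : x₀ ≠ 0) : (0 : Matrix (Fin 2) (Fin 2) F) ∉ MulAction.orbit ↥Gp x₀ :=
  fun h => (isNilpotent_and_ne_zero_of_mem_orbit_subgroup Gp hx₀ h0 h).2 rfl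

/-- The `Gp`-orbit is `Gp`-stable. [cite: BernsteinZelevinsky1976, §1.5] -/
theorem smul_mem_orbit_subgroup {y : Matrix (Fin 2) (Fin 2) F} (hy : y ∈ MulAction.orbit ↥Gp x₀) (h : ↥Gp) :
    (h : ConjAct (GL (Fin 2) F)) • y ∈ MulAction.orbit ↥Gp x₀ := by
  obtain ⟨k, rfl⟩ := MulAction.mem_orbit_iff.1 hy
  exact MulAction.mem_orbit_iff.2 ⟨h * k, by rw [mul_smul]; rfl⟩

/-- Two `Gp`-orbits in the cone are equal or disjoint. [cite: BernsteinZelevinsky1976, §1.5] -/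
theorem orbit_subgroup_disjoint_or_eq (y : Matrix (Fin 2) (Fin 2) F) :
    Disjoint (MulAction.orbit ↥Gp y) (MulAction.orbit ↥Gp x₀) ∨ MulAction.orbit ↥Gp y = MulAction.orbit ↥Gp x₀ := by
  by_cases h : Disjoint (MulAction.orbit ↥Gp y) (MulAction.orbit ↥Gp x₀)
  · exact Or.inl h
  · right
    obtain ⟨z, hzy, hzx⟩ := Set.not_disjoint_iff.1 h
    rw [← MulAction.orbit_eq_iff.2 hzy, ← MulAction.orbit_eq_iff.2 hzx]

/-- **The orbit is stable**, so pre-images under the orbit action are read in `𝔤𝔩₂(F)`: `val '' ((h • ·)⁻¹' s) = (Ad h)⁻¹' (val '' s)` for `h ∈ Gp`, `s ⊆ ↥𝒪`.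
[cite: BernsteinZelevinsky1976, §1.5] -/
theorem image_val_preimage_smul_subgroup (c : ↥Gp) (s : Set ↥(MulAction.orbit ↥Gp x₀)) :
    Subtype.val '' ((fun x : ↥(MulAction.orbit ↥Gp x₀) => c • x) ⁻¹' s) =
      (fun Y : Matrix (Fin 2) (Fin 2) F => ((ConjAct.ofConjAct (c : ConjAct (GL (Fin 2) F)) : GL (Fin 2) F) : Matrix (Fin 2) (Fin 2) F) * Y *
        (((ConjAct.ofConjAct (c : ConjAct (GL (Fin 2) F)))⁻¹ : GL (Fin 2) F) : Matrix (Fin 2) (Fin 2) F)) ⁻¹' (Subtype.val '' s) := by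
  ext Y
  simp only [Set.mem_image, Set.mem_preimage]
  constructor
  · rintro ⟨x, hx, rfl⟩
    refine ⟨c • x, hx, ?_⟩
    rw [MulAction.orbit.coe_smul, Subgroup.smul_def, ConjAct.units_smul_def]
  · rintro ⟨x', hx', hY⟩
    rw [← ConjAct.units_smul_def, ← Subgroup.smul_def] at hY
    have hYmem : Y ∈ MulAction.orbit ↥Gp x₀ := by
      have hY' : Y = c⁻¹ • (x' : Matrix (Fin 2) (Fin 2) F) := by rw [hY, inv_smul_smul]
      rw [hY', ← MulAction.orbit.coe_smul]
      exact (c⁻¹ • x').2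
    refine ⟨⟨Y, hYmem⟩, ?_, rfl⟩
    have hx : c • (⟨Y, hYmem⟩ : ↥(MulAction.orbit ↥Gp x₀)) = x' := Subtype.ext (by rw [MulAction.orbit.coe_smul, ← hY])
    rw [hx]
    exact hx'

variable [TopologicalSpace F] [IsTopologicalRing F]

/-- The orbit action `x ↦ h • x` on `↥𝒪` is continuous. [cite: BernsteinZelevinsky1976, §1.5] -/
theorem continuous_smul_orbit_subgroup (c : ↥Gp) : Continuous fun x : ↥(MulAction.orbit ↥Gp x₀) => c • x := by
  have h : Continuous fun x : ↥(MulAction.orbit ↥Gp x₀) => (c : ConjAct (GL (Fin 2) F)) • (x : Matrix (Fin 2) (Fin 2) F) :=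
    (continuous_const_smul (c : ConjAct (GL (Fin 2) F))).comp continuous_subtype_val
  exact h.subtype_mk _

end Orbit

/-! ## §2  Over a non-archimedean local field: the `Gp`-orbit is clopen in `𝒩 ∖ {0}` (open-mapping theorem) -/

section LocalField

variable {F : Type*} [Field F] [ValuativeRel F] [TopologicalSpace F] [IsNonarchimedeanLocalField F]
  (Gp : Subgroup (ConjAct (GL (Fin 2) F))) {x₀ : Matrix (Fin 2) (Fin 2) F}

/-- **`𝒪 = U ∩ (𝒩 ∖ {0})` with `U` open.**  The orbit map `g ↦ g • x₀ : ConjAct GL₂(F) → 𝒩 ∖ {0}` is OPEN (Mathlib's Baire-category open-mapping theorem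
`isOpenMap_smul_of_sigmaCompact`: the σ-compact group acts continuously and transitively on the locally compact orbit, ★ `isLocallyClosed_orbit_nilpOne`), and
`Gp` is open; the `Gp`-orbit of `x₀` is the image of `Gp`. [cite: BernsteinZelevinsky1976, §1.5] [cite: HarishChandra1999AdmissibleDistributions, §3 p. 9] -/
theorem exists_isOpen_inter_orbit_eq (hGp : IsOpen {g : GL (Fin 2) F | ConjAct.toConjAct g ∈ Gp}) (hx₀ : IsNilpotent x₀) (h0 : x₀ ≠ 0) :
    ∃ U : Set (Matrix (Fin 2) (Fin 2) F), IsOpen U ∧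
      U ∩ MulAction.orbit (ConjAct (GL (Fin 2) F)) (!![0, 1; 0, 0] : Matrix (Fin 2) (Fin 2) F) = MulAction.orbit ↥Gp x₀ := by
  classical
  -- topology of `F`, `𝔤𝔩₂(F)`, `GL₂(F)` and the synonym `ConjAct (GL (Fin 2) F)` (as in ★ S2c)
  haveI : T2Space F := (isLocalField F).toT2Space
  haveI : LocallyCompactSpace F := (isLocalField F).toLocallyCompactSpace
  haveI : SecondCountableTopology F := secondCountableTopology_localField F
  haveI : LocallyCompactSpace (Matrix (Fin 2) (Fin 2) F) := Pi.locallyCompactSpace_of_finite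
  haveI : SecondCountableTopology (Matrix (Fin 2) (Fin 2) F) := inferInstanceAs (SecondCountableTopology (Fin 2 → Fin 2 → F))
  haveI : SigmaCompactSpace (Matrix (Fin 2) (Fin 2) F) := inferInstanceAs (SigmaCompactSpace (Fin 2 → Fin 2 → F))
  haveI : SigmaCompactSpace (Matrix (Fin 2) (Fin 2) F)ᵐᵒᵖ := MulOpposite.opHomeomorph.symm.isClosedEmbedding.sigmaCompactSpace
  haveI : SigmaCompactSpace (GL (Fin 2) F) := Units.isClosedEmbedding_embedProduct.sigmaCompactSpace
  letI : TopologicalSpace (ConjAct (GL (Fin 2) F)) := (inferInstance : TopologicalSpace (GL (Fin 2) F))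
  haveI : IsTopologicalGroup (ConjAct (GL (Fin 2) F)) := (inferInstance : IsTopologicalGroup (GL (Fin 2) F))
  haveI : SigmaCompactSpace (ConjAct (GL (Fin 2) F)) := (inferInstance : SigmaCompactSpace (GL (Fin 2) F))
  haveI : ContinuousSMul (ConjAct (GL (Fin 2) F)) (Matrix (Fin 2) (Fin 2) F) := by
    refine ⟨?_⟩
    have hc1 : Continuous fun p : ConjAct (GL (Fin 2) F) × Matrix (Fin 2) (Fin 2) F =>
        ((ConjAct.ofConjAct p.1 : GL (Fin 2) F) : Matrix (Fin 2) (Fin 2) F) := Units.continuous_val.comp continuous_fst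
    have hc3 : Continuous fun p : ConjAct (GL (Fin 2) F) × Matrix (Fin 2) (Fin 2) F =>
        (((ConjAct.ofConjAct p.1)⁻¹ : GL (Fin 2) F) : Matrix (Fin 2) (Fin 2) F) := Units.continuous_coe_inv.comp continuous_fst
    exact (hc1.mul continuous_snd).mul hc3
  haveI : LocallyCompactSpace ↥(MulAction.orbit (ConjAct (GL (Fin 2) F)) (!![0, 1; 0, 0] : Matrix (Fin 2) (Fin 2) F)) :=
    locallyCompactSpace_orbit_nilpOne (F := F)
  haveI : ContinuousSMul (ConjAct (GL (Fin 2) F)) ↥(MulAction.orbit (ConjAct (GL (Fin 2) F)) (!![0, 1; 0, 0] : Matrix (Fin 2) (Fin 2) F)) :=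
    Literature.MeasureTheory.Group.continuousSMul_orbit _
  -- the base point inside the big orbit, and the open image of `Gp`
  set x₁ : ↥(MulAction.orbit (ConjAct (GL (Fin 2) F)) (!![0, 1; 0, 0] : Matrix (Fin 2) (Fin 2) F)) := ⟨x₀, (mem_orbit_nilpOne_iff x₀).2 ⟨hx₀, h0⟩⟩ with hx₁
  have himg : IsOpen ((fun g : ConjAct (GL (Fin 2) F) => g • x₁) '' (Gp : Set (ConjAct (GL (Fin 2) F)))) :=
    isOpenMap_smul_of_sigmaCompact x₁ _ hGp
  obtain ⟨U, hU, hUeq⟩ := isOpen_induced_iff.1 himg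
  refine ⟨U, hU, ?_⟩
  have hval : (Subtype.val : ↥(MulAction.orbit (ConjAct (GL (Fin 2) F)) (!![0, 1; 0, 0] : Matrix (Fin 2) (Fin 2) F)) → Matrix (Fin 2) (Fin 2) F) ''
      ((Subtype.val : ↥(MulAction.orbit (ConjAct (GL (Fin 2) F)) (!![0, 1; 0, 0] : Matrix (Fin 2) (Fin 2) F)) → Matrix (Fin 2) (Fin 2) F) ⁻¹' U) =
      U ∩ MulAction.orbit (ConjAct (GL (Fin 2) F)) (!![0, 1; 0, 0] : Matrix (Fin 2) (Fin 2) F) := by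
    rw [Set.image_preimage_eq_inter_range, Subtype.range_coe]
  rw [← hval, hUeq]
  ext y
  simp only [Set.mem_image, SetLike.mem_coe]
  constructor
  · rintro ⟨_, ⟨g, hg, rfl⟩, rfl⟩
    exact MulAction.mem_orbit_iff.2 ⟨⟨g, hg⟩, rfl⟩
  · intro hy
    obtain ⟨h, rfl⟩ := MulAction.mem_orbit_iff.1 hy
    exact ⟨(h : ConjAct (GL (Fin 2) F)) • x₁, ⟨h, h.2, rfl⟩, rfl⟩

/-- **The complement `(𝒩 ∖ {0}) ∖ 𝒪` is (relatively) open too**: it is the union of the other `Gp`-orbits, each of the form `U_y ∩ (𝒩 ∖ {0})`.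
[cite: BernsteinZelevinsky1976, §1.5] -/
theorem exists_isOpen_inter_orbit_eq_diff (hGp : IsOpen {g : GL (Fin 2) F | ConjAct.toConjAct g ∈ Gp}) :
    ∃ V : Set (Matrix (Fin 2) (Fin 2) F), IsOpen V ∧
      V ∩ MulAction.orbit (ConjAct (GL (Fin 2) F)) (!![0, 1; 0, 0] : Matrix (Fin 2) (Fin 2) F) =
        MulAction.orbit (ConjAct (GL (Fin 2) F)) (!![0, 1; 0, 0] : Matrix (Fin 2) (Fin 2) F) \ MulAction.orbit ↥Gp x₀ := by
  classical
  -- for every point `y` of the big orbit, an open `U y` cutting out its `Gp`-orbit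
  have hU : ∀ y : ↥(MulAction.orbit (ConjAct (GL (Fin 2) F)) (!![0, 1; 0, 0] : Matrix (Fin 2) (Fin 2) F)),
      ∃ U : Set (Matrix (Fin 2) (Fin 2) F), IsOpen U ∧
        U ∩ MulAction.orbit (ConjAct (GL (Fin 2) F)) (!![0, 1; 0, 0] : Matrix (Fin 2) (Fin 2) F) = MulAction.orbit ↥Gp (y : Matrix (Fin 2) (Fin 2) F) :=
    fun y => exists_isOpen_inter_orbit_eq Gp hGp ((mem_orbit_nilpOne_iff _).1 y.2).1 ((mem_orbit_nilpOne_iff _).1 y.2).2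
  choose U hUo hUeq using hU
  refine ⟨⋃ y ∈ {y : ↥(MulAction.orbit (ConjAct (GL (Fin 2) F)) (!![0, 1; 0, 0] : Matrix (Fin 2) (Fin 2) F)) |
      (y : Matrix (Fin 2) (Fin 2) F) ∉ MulAction.orbit ↥Gp x₀}, U y, isOpen_biUnion fun y _ => hUo y, ?_⟩
  ext z
  simp only [Set.mem_inter_iff, Set.mem_iUnion, Set.mem_setOf_eq, Set.mem_sdiff, exists_prop]
  constructor
  · rintro ⟨⟨y, hy, hzU⟩, hz⟩
    have hz' : z ∈ MulAction.orbit ↥Gp (y : Matrix (Fin 2) (Fin 2) F) := by rw [← hUeq y]; exact ⟨hzU, hz⟩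
    refine ⟨hz, fun hzx => hy ?_⟩
    -- `z` lies in both orbits, so they coincide and `y ∈ 𝒪`
    rw [← MulAction.orbit_eq_iff.2 hzx, MulAction.orbit_eq_iff.2 hz']
    exact MulAction.mem_orbit_self _
  · rintro ⟨hz, hzx⟩
    refine ⟨⟨⟨z, hz⟩, hzx, ?_⟩, hz⟩
    have : z ∈ U ⟨z, hz⟩ ∩ MulAction.orbit (ConjAct (GL (Fin 2) F)) (!![0, 1; 0, 0] : Matrix (Fin 2) (Fin 2) F) := by
      rw [hUeq]; exact MulAction.mem_orbit_self _
    exact this.1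

/-- **The `Gp`-orbit is LOCALLY CLOSED in `𝔤𝔩₂(F)`** (open piece of the locally closed `𝒩 ∖ {0}`, ★ `isLocallyClosed_orbit_nilpOne`).
[cite: BernsteinZelevinsky1976, §1.5] -/
theorem isLocallyClosed_orbit_subgroup (hGp : IsOpen {g : GL (Fin 2) F | ConjAct.toConjAct g ∈ Gp}) (hx₀ : IsNilpotent x₀) (h0 : x₀ ≠ 0) :
    IsLocallyClosed (MulAction.orbit ↥Gp x₀) := by
  haveI : T2Space F := (isLocalField F).toT2Space
  obtain ⟨U, hU, hUeq⟩ := exists_isOpen_inter_orbit_eq Gp hGp hx₀ h0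
  rw [← hUeq]
  exact hU.isLocallyClosed.inter (isLocallyClosed_orbit_nilpOne (F := F))

/-- The closure of the `Gp`-orbit adds at most the point `0`: `closure 𝒪 ⊆ 𝒪 ∪ {0}` (`𝒪` is closed in `𝒩 ∖ {0}`, whose closure is `𝒩`).
[cite: HarishChandra1999AdmissibleDistributions, §3 p. 8] -/
theorem closure_orbit_subgroup_subset (hGp : IsOpen {g : GL (Fin 2) F | ConjAct.toConjAct g ∈ Gp}) (hx₀ : IsNilpotent x₀) (h0 : x₀ ≠ 0) :
    closure (MulAction.orbit ↥Gp x₀) ⊆ insert (0 : Matrix (Fin 2) (Fin 2) F) (MulAction.orbit ↥Gp x₀) := by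
  haveI : T2Space F := (isLocalField F).toT2Space
  intro z hz
  by_cases hzO : z ∈ MulAction.orbit ↥Gp x₀
  · exact Or.inr hzO
  have hbig : z ∈ insert (0 : Matrix (Fin 2) (Fin 2) F) (MulAction.orbit (ConjAct (GL (Fin 2) F)) (!![0, 1; 0, 0] : Matrix (Fin 2) (Fin 2) F)) :=
    closure_orbit_nilpOne_subset (closure_mono (orbit_subgroup_subset Gp hx₀ h0) hz)
  rcases hbig with h | h
  · exact Or.inl h
  · -- `z ∈ (𝒩 ∖ {0}) ∖ 𝒪 = V ∩ (𝒩 ∖ {0})`, `V` open and disjoint from `𝒪`: contradiction with `z ∈ closure 𝒪`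
    exfalso
    obtain ⟨V, hV, hVeq⟩ := exists_isOpen_inter_orbit_eq_diff Gp hGp
    have hzV : z ∈ V := by
      have : z ∈ V ∩ MulAction.orbit (ConjAct (GL (Fin 2) F)) (!![0, 1; 0, 0] : Matrix (Fin 2) (Fin 2) F) := by rw [hVeq]; exact ⟨h, hzO⟩
      exact this.1
    obtain ⟨y, hyV, hyO⟩ := mem_closure_iff.1 hz V hV hzV
    have : y ∈ V ∩ MulAction.orbit (ConjAct (GL (Fin 2) F)) (!![0, 1; 0, 0] : Matrix (Fin 2) (Fin 2) F) := ⟨hyV, orbit_subgroup_subset Gp hx₀ h0 hyO⟩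
    rw [hVeq] at this
    exact this.2 hyO

/-- **`𝒩 ∖ 𝒪` is CLOSED** (`𝒪 = (U ∖ {0}) ∩ 𝒩` with `U` open) — the closed invariant set the test-function extensions of FILE 2 must avoid.
[cite: HarishChandra1999AdmissibleDistributions, §3 p. 10] -/
theorem isClosed_setOf_isNilpotent_diff_orbit_subgroup (hGp : IsOpen {g : GL (Fin 2) F | ConjAct.toConjAct g ∈ Gp}) (hx₀ : IsNilpotent x₀) (h0 : x₀ ≠ 0) :
    IsClosed ({N : Matrix (Fin 2) (Fin 2) F | IsNilpotent N} \ MulAction.orbit ↥Gp x₀) := by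
  haveI : T2Space F := (isLocalField F).toT2Space
  obtain ⟨U, hU, hUeq⟩ := exists_isOpen_inter_orbit_eq Gp hGp hx₀ h0
  have h : {N : Matrix (Fin 2) (Fin 2) F | IsNilpotent N} \ MulAction.orbit ↥Gp x₀ = {N : Matrix (Fin 2) (Fin 2) F | IsNilpotent N} ∩ (U ∩ {0}ᶜ)ᶜ := by
    rw [← hUeq, orbit_nilpOne_eq]
    ext N
    simp only [Set.mem_sdiff, Set.mem_inter_iff, Set.mem_setOf_eq, Set.mem_compl_iff, Set.mem_singleton_iff, not_and, not_not]
    tauto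
  rw [h]
  exact (isClosed_setOf_isNilpotent (F := F)).inter (hU.inter isOpen_compl_singleton).isClosed_compl

/-- The `Gp`-orbit is a Borel set. [cite: BernsteinZelevinsky1976, §1.5] -/
theorem measurableSet_orbit_subgroup [MeasurableSpace (Matrix (Fin 2) (Fin 2) F)] [OpensMeasurableSpace (Matrix (Fin 2) (Fin 2) F)]
    (hGp : IsOpen {g : GL (Fin 2) F | ConjAct.toConjAct g ∈ Gp}) (hx₀ : IsNilpotent x₀) (h0 : x₀ ≠ 0) : MeasurableSet (MulAction.orbit ↥Gp x₀) := by
  haveI : T2Space F := (isLocalField F).toT2Space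
  obtain ⟨U, hU, hUeq⟩ := exists_isOpen_inter_orbit_eq Gp hGp hx₀ h0
  rw [← hUeq]
  exact hU.measurableSet.inter (measurableSet_orbit_nilpOne (F := F))

/-- The orbit `↥𝒪` is locally compact (locally closed in the locally compact `𝔤𝔩₂(F)`), hence a Baire space. [cite: BernsteinZelevinsky1976, §1.5] -/
theorem locallyCompactSpace_orbit_subgroup (hGp : IsOpen {g : GL (Fin 2) F | ConjAct.toConjAct g ∈ Gp}) (hx₀ : IsNilpotent x₀) (h0 : x₀ ≠ 0) :
    LocallyCompactSpace ↥(MulAction.orbit ↥Gp x₀) := by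
  haveI : T2Space F := (isLocalField F).toT2Space
  haveI : LocallyCompactSpace F := (isLocalField F).toLocallyCompactSpace
  haveI : LocallyCompactSpace (Matrix (Fin 2) (Fin 2) F) := Pi.locallyCompactSpace_of_finite
  exact (isLocallyClosed_orbit_subgroup Gp hGp hx₀ h0).locallyCompactSpace

/-! ## §3  The invariant measure `μ = val^* ν` on the `Gp`-orbit -/

variable [MeasurableSpace F] [BorelSpace F] [MeasurableSpace (GL (Fin 2) F)] [BorelSpace (GL (Fin 2) F)]
  [MeasurableSpace (Matrix (Fin 2) (Fin 2) F)] [BorelSpace (Matrix (Fin 2) (Fin 2) F)]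
  (κ : Measure ↥(glInt 2 F)) (dx : Measure F)

omit [BorelSpace F] [BorelSpace (GL (Fin 2) F)] in
/-- `μ s = ν (val '' s)` on the `Gp`-orbit. [cite: BernsteinZelevinsky1976, §1.18] -/
theorem comap_val_apply_subgroup (hGp : IsOpen {g : GL (Fin 2) F | ConjAct.toConjAct g ∈ Gp}) (hx₀ : IsNilpotent x₀) (h0 : x₀ ≠ 0)
    (s : Set ↥(MulAction.orbit ↥Gp x₀)) :
    (Measure.comap (Subtype.val : ↥(MulAction.orbit ↥Gp x₀) → Matrix (Fin 2) (Fin 2) F)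
      ((κ.prod dx).map fun p : ↥(glInt 2 F) × F =>
        ((p.1 : GL (Fin 2) F) : Matrix (Fin 2) (Fin 2) F) * !![0, p.2; 0, 0] * ((((p.1 : GL (Fin 2) F))⁻¹ : GL (Fin 2) F) : Matrix (Fin 2) (Fin 2) F))) s =
    ((κ.prod dx).map fun p : ↥(glInt 2 F) × F =>
        ((p.1 : GL (Fin 2) F) : Matrix (Fin 2) (Fin 2) F) * !![0, p.2; 0, 0] * ((((p.1 : GL (Fin 2) F))⁻¹ : GL (Fin 2) F) : Matrix (Fin 2) (Fin 2) F))
      (Subtype.val '' s) :=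
  comap_subtype_coe_apply (measurableSet_orbit_subgroup Gp hGp hx₀ h0) _ s

/-- **`μ` is finite on compact sets** (★ `isFiniteMeasureOnCompacts_map_conjNilp`). [cite: HarishChandra1999AdmissibleDistributions, §3 p. 9] -/
theorem isFiniteMeasureOnCompacts_comap_val_subgroup [IsFiniteMeasureOnCompacts κ] [IsFiniteMeasureOnCompacts dx]
    (hGp : IsOpen {g : GL (Fin 2) F | ConjAct.toConjAct g ∈ Gp}) (hx₀ : IsNilpotent x₀) (h0 : x₀ ≠ 0) :
    IsFiniteMeasureOnCompacts (Measure.comap (Subtype.val : ↥(MulAction.orbit ↥Gp x₀) → Matrix (Fin 2) (Fin 2) F)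
      ((κ.prod dx).map fun p : ↥(glInt 2 F) × F =>
        ((p.1 : GL (Fin 2) F) : Matrix (Fin 2) (Fin 2) F) * !![0, p.2; 0, 0] * ((((p.1 : GL (Fin 2) F))⁻¹ : GL (Fin 2) F) : Matrix (Fin 2) (Fin 2) F))) := by
  haveI := isFiniteMeasureOnCompacts_map_conjNilp (F := F) κ dx
  refine ⟨fun K hK => ?_⟩
  rw [comap_val_apply_subgroup Gp κ dx hGp hx₀ h0]
  exact (hK.image continuous_subtype_val).measure_lt_top

/-- **`μ` is `Gp`-invariant** (★ `map_conj_map_conjNilp`: `Ad(g)_* ν = ν` for every `g ∈ GL₂(F)`, and `val '' ((h • ·)⁻¹' s) = (Ad h)⁻¹' (val '' s)`).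
[cite: HarishChandra1999AdmissibleDistributions, §3 pp. 8–10] [cite: BernsteinZelevinsky1976, §1.18] -/
theorem smulInvariantMeasure_comap_val_subgroup [IsHaarMeasure κ] [dx.IsAddHaarMeasure]
    (hGp : IsOpen {g : GL (Fin 2) F | ConjAct.toConjAct g ∈ Gp}) (hx₀ : IsNilpotent x₀) (h0 : x₀ ≠ 0) :
    SMulInvariantMeasure ↥Gp ↥(MulAction.orbit ↥Gp x₀)
      (Measure.comap (Subtype.val : ↥(MulAction.orbit ↥Gp x₀) → Matrix (Fin 2) (Fin 2) F)
        ((κ.prod dx).map fun p : ↥(glInt 2 F) × F =>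
          ((p.1 : GL (Fin 2) F) : Matrix (Fin 2) (Fin 2) F) * !![0, p.2; 0, 0] * ((((p.1 : GL (Fin 2) F))⁻¹ : GL (Fin 2) F) : Matrix (Fin 2) (Fin 2) F))) := by
  haveI : T2Space F := (isLocalField F).toT2Space
  haveI : SecondCountableTopology F := secondCountableTopology_localField F
  haveI : SecondCountableTopology (GL (Fin 2) F) := secondCountableTopology_gl_two (F := F)
  refine ⟨fun c s hs => ?_⟩
  have hO := measurableSet_orbit_subgroup Gp hGp hx₀ h0
  have hAd : Measurable fun Y : Matrix (Fin 2) (Fin 2) F => ((ConjAct.ofConjAct (c : ConjAct (GL (Fin 2) F)) : GL (Fin 2) F) : Matrix (Fin 2) (Fin 2) F) * Y *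
      (((ConjAct.ofConjAct (c : ConjAct (GL (Fin 2) F)))⁻¹ : GL (Fin 2) F) : Matrix (Fin 2) (Fin 2) F) :=
    (continuous_conj (ConjAct.ofConjAct (c : ConjAct (GL (Fin 2) F)))).measurable
  rw [comap_val_apply_subgroup Gp κ dx hGp hx₀ h0, comap_val_apply_subgroup Gp κ dx hGp hx₀ h0, image_val_preimage_smul_subgroup,
    ← Measure.map_apply hAd (hO.subtype_image hs), map_conj_map_conjNilp κ dx (ConjAct.ofConjAct (c : ConjAct (GL (Fin 2) F)))]

/-- **`μ ≠ 0`**: `μ(X) = ν(𝒪) ≥ ν(U) − ν((𝒩 ∖ {0})ᶜ) = ν(U) > 0`, since `chart⁻¹(U)` is a non-empty open subset of `GL₂(𝒪) × F` (`x₀ = k (tE₁₂) k⁻¹`,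
★ `exists_glInt_conj_nilp_eq`) and `κ ⊗ dx` is positive on opens. [cite: HarishChandra1999AdmissibleDistributions, §3 p. 9] -/
theorem comap_val_subgroup_ne_zero [IsHaarMeasure κ] [dx.IsAddHaarMeasure]
    (hGp : IsOpen {g : GL (Fin 2) F | ConjAct.toConjAct g ∈ Gp}) (hx₀ : IsNilpotent x₀) (h0 : x₀ ≠ 0) :
    Measure.comap (Subtype.val : ↥(MulAction.orbit ↥Gp x₀) → Matrix (Fin 2) (Fin 2) F)
      ((κ.prod dx).map fun p : ↥(glInt 2 F) × F =>
        ((p.1 : GL (Fin 2) F) : Matrix (Fin 2) (Fin 2) F) * !![0, p.2; 0, 0] * ((((p.1 : GL (Fin 2) F))⁻¹ : GL (Fin 2) F) : Matrix (Fin 2) (Fin 2) F)) ≠ 0 := by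
  haveI : T2Space F := (isLocalField F).toT2Space
  haveI : SecondCountableTopology F := secondCountableTopology_localField F
  haveI : CompactSpace ↥(glInt 2 F) := isCompact_iff_compactSpace.1 (isCompact_glInt 2 F)
  haveI : BorelSpace ↥(glInt 2 F) := Subtype.borelSpace _
  obtain ⟨U, hU, hUeq⟩ := exists_isOpen_inter_orbit_eq Gp hGp hx₀ h0
  intro h
  have h1 : (Measure.comap (Subtype.val : ↥(MulAction.orbit ↥Gp x₀) → Matrix (Fin 2) (Fin 2) F)
      ((κ.prod dx).map fun p : ↥(glInt 2 F) × F =>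
        ((p.1 : GL (Fin 2) F) : Matrix (Fin 2) (Fin 2) F) * !![0, p.2; 0, 0] * ((((p.1 : GL (Fin 2) F))⁻¹ : GL (Fin 2) F) : Matrix (Fin 2) (Fin 2) F))) Set.univ = 0 := by
    rw [h, Measure.coe_zero, Pi.zero_apply]
  rw [comap_val_apply_subgroup Gp κ dx hGp hx₀ h0, Set.image_univ, Subtype.range_coe] at h1
  -- `ν U ≤ ν 𝒪 + ν ((𝒩 ∖ {0})ᶜ) = 0`
  have hνU : ((κ.prod dx).map fun p : ↥(glInt 2 F) × F =>
      ((p.1 : GL (Fin 2) F) : Matrix (Fin 2) (Fin 2) F) * !![0, p.2; 0, 0] * ((((p.1 : GL (Fin 2) F))⁻¹ : GL (Fin 2) F) : Matrix (Fin 2) (Fin 2) F)) U = 0 := by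
    refine le_antisymm ?_ bot_le
    have hsub : U ⊆ MulAction.orbit ↥Gp x₀ ∪ (MulAction.orbit (ConjAct (GL (Fin 2) F)) (!![0, 1; 0, 0] : Matrix (Fin 2) (Fin 2) F))ᶜ := by
      intro z hz
      by_cases hzb : z ∈ MulAction.orbit (ConjAct (GL (Fin 2) F)) (!![0, 1; 0, 0] : Matrix (Fin 2) (Fin 2) F)
      · left; rw [← hUeq]; exact ⟨hz, hzb⟩
      · exact Or.inr hzb
    calc _ ≤ _ := measure_mono hsub
      _ ≤ _ := measure_union_le _ _
      _ = 0 := by rw [h1, map_conjNilp_apply_compl_orbit κ dx, add_zero]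
  -- but `ν U = (κ ⊗ dx)(chart⁻¹ U) > 0`
  rw [Measure.map_apply (measurable_conjNilp (F := F)) hU.measurableSet] at hνU
  obtain ⟨k, hk, t, -, hkt⟩ := exists_glInt_conj_nilp_eq hx₀ h0
  have hne : ((fun p : ↥(glInt 2 F) × F =>
      ((p.1 : GL (Fin 2) F) : Matrix (Fin 2) (Fin 2) F) * !![0, p.2; 0, 0] * ((((p.1 : GL (Fin 2) F))⁻¹ : GL (Fin 2) F) : Matrix (Fin 2) (Fin 2) F)) ⁻¹' U).Nonempty := by
    refine ⟨(⟨k, hk⟩, t), ?_⟩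
    show ((k : GL (Fin 2) F) : Matrix (Fin 2) (Fin 2) F) * !![0, t; 0, 0] * ((k⁻¹ : GL (Fin 2) F) : Matrix (Fin 2) (Fin 2) F) ∈ U
    rw [hkt]
    have : x₀ ∈ U ∩ MulAction.orbit (ConjAct (GL (Fin 2) F)) (!![0, 1; 0, 0] : Matrix (Fin 2) (Fin 2) F) := by rw [hUeq]; exact MulAction.mem_orbit_self _
    exact this.1
  exact ((hU.preimage (continuous_conjNilp (F := F))).measure_pos (κ.prod dx) hne).ne' hνU

/-- **Integration on the `Gp`-orbit is the `Gp`-orbital integral in the `K × F` chart**: `∫_X f(val x) dμ = ∫_{chart⁻¹ 𝒪} f(chart p) d(κ ⊗ dx)`.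
[cite: HarishChandra1999AdmissibleDistributions, §3 p. 9] [cite: BernsteinZelevinsky1976, §1.18] -/
theorem integral_comp_val_comap_val_subgroup [SFinite κ] [SFinite dx] (hGp : IsOpen {g : GL (Fin 2) F | ConjAct.toConjAct g ∈ Gp})
    (hx₀ : IsNilpotent x₀) (h0 : x₀ ≠ 0) {E : Type*} [NormedAddCommGroup E] [NormedSpace ℝ E] {f : Matrix (Fin 2) (Fin 2) F → E}
    (hf : AEStronglyMeasurable f ((κ.prod dx).map fun p : ↥(glInt 2 F) × F =>
      ((p.1 : GL (Fin 2) F) : Matrix (Fin 2) (Fin 2) F) * !![0, p.2; 0, 0] * ((((p.1 : GL (Fin 2) F))⁻¹ : GL (Fin 2) F) : Matrix (Fin 2) (Fin 2) F))) :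
    ∫ x : ↥(MulAction.orbit ↥Gp x₀), f (x : Matrix (Fin 2) (Fin 2) F) ∂(Measure.comap (Subtype.val : ↥(MulAction.orbit ↥Gp x₀) → Matrix (Fin 2) (Fin 2) F)
      ((κ.prod dx).map fun p : ↥(glInt 2 F) × F =>
        ((p.1 : GL (Fin 2) F) : Matrix (Fin 2) (Fin 2) F) * !![0, p.2; 0, 0] * ((((p.1 : GL (Fin 2) F))⁻¹ : GL (Fin 2) F) : Matrix (Fin 2) (Fin 2) F))) =
    ∫ p in {p : ↥(glInt 2 F) × F | ((p.1 : GL (Fin 2) F) : Matrix (Fin 2) (Fin 2) F) * !![0, p.2; 0, 0] *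
        ((((p.1 : GL (Fin 2) F))⁻¹ : GL (Fin 2) F) : Matrix (Fin 2) (Fin 2) F) ∈ MulAction.orbit ↥Gp x₀},
      f (((p.1 : GL (Fin 2) F) : Matrix (Fin 2) (Fin 2) F) * !![0, p.2; 0, 0] * ((((p.1 : GL (Fin 2) F))⁻¹ : GL (Fin 2) F) : Matrix (Fin 2) (Fin 2) F)) ∂(κ.prod dx) := by
  haveI : T2Space F := (isLocalField F).toT2Space
  have hO := measurableSet_orbit_subgroup Gp hGp hx₀ h0
  rw [integral_subtype_comap hO, setIntegral_map hO hf (measurable_conjNilp (F := F)).aemeasurable]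
  rfl

end LocalField

end Summit.HodgeConjecture.HodgeConjecture.Cruxes.H413.K2E3GL2NilpotentSubgroupOrbitSpace
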